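import Mathlib
import Summits.Ventures.HodgeRepro.Tier4.Line4.IntegProper
import Summits.Ventures.HodgeRepro.Tier4.Line4.LevelIndicator
import Summits.Ventures.HodgeRepro.Tier4.Line4.OrbitProper

/-!
# Tier4/Line4/ChainInputsFin — C-L4-CHAININPUTS-FIN: the finite-side clauses `hB`, `hIfin`, `hint` of `ChainInputs` at
the witness's finite factor `Ffin = levelDC W γ₀ N`

Blind re-derivation cell `pub-hodge-repro`, Tier 4 «prove the step» (README §9–§10), seat t4-L1-p1 g5 (prover, LINE L4
chair; the cut of plan-4 g6 S15802).  Tree path `lean/Summits/Ventures/HodgeRepro/Tier4/Line4/ChainInputsFin.lean`.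
Mathlib-level; no literature; no `def`.

THE OBJECT.  TailGlueMain's `hchain` binder (bd52e6ad59539fe8 L194–L200) asks `ChainInputs W R γ₀ νinf νf νinf' νf' DZf
F Finf Ffin` (MainTermInstance p708127 L59–L88) at `Ffin := levelDC W γ₀ (p^(N+n₁))`, the indicator of the level double
coset `K(N) γ₀,f K(N)` on the finite coordinate (LevelIndicator p706611).  The three FINITE-side clauses are
* `hB`: for every `t ∈ T`, `b ↦ conj χ′(b) · levelDC (t_f⁻¹ γ₀,f b)` is `ν′_f`-integrable on `T′_f`;
* `hIfin`: `b ↦ χ(b) · innerFin (levelDC) γ₀ ν′_f b` is `ν_f`-integrable on `DZ_f`;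
* `hint`: `(b, b′) ↦ χ(b) conj χ′(b′) levelDC (b⁻¹ γ₀,f b′)` is `(ν_f ⊗ ν′_f)`-integrable on `DZ_f × T′_f`.

WHAT IS PROVED (every declaration sorry-free, axioms `[propext, Classical.choice, Quot.sound]`).
* `integrable_conj_chi'_mul_levelDC` (= `hB`): the integrand is continuous (`continuous_levelDC`, `N ≠ 0`) and its
  support is the trace on `T′_f` of the compact translate `(γ₀,f⁻¹ t_f) · K(N) γ₀,f K(N)` — compact by L2-p1's closed
  embedding `isClosedEmbedding_torusFin'_coe` — so `Continuous.integrable_of_hasCompactSupport` (Haar = finite on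
  compacts).  No PROPER, no domain.
* `integrableOn_chi_mul_innerFin_levelDC` (= `hIfin`) and `integrableOn_chi_conj_chi'_levelDC_prod` (= `hint`): L2-p1's
  C-L4-INTEG theorems `integrableOn_chi_mul_innerFin` / `integrableOn_chi_conj_chi'_Ffin_prod` (IntegProper) at
  `Ffin := levelDC`, `Cf := K(N) γ₀,f K(N)` (compact, `isCompact_levelDoubleCoset`), `hFsupp` =
  `mem_levelDoubleCoset_of_levelDC_ne_zero`; the binders are PROPER `hprop : HasProperFinOrbit W γ₀` (a THEOREM for a
  LIN-regular rational `γ₀`: L2-p3's `hasProperFinOrbit_of_isLinRegular (hdet) (hg) γ₀ (hreg)`, OrbitProper — the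
  `_of_isLinRegular` forms below discharge it) and ZDOMAIN-EX (iv) `hDZc` on an ARBITRARY measurable `DZf`
  (R-DZF-OF-RECORD S15790); no `hDZ`, no product domain.
* `chainInputs_fin_clauses_of_isLinRegular`: the three clauses bundled, PROPER discharged from `hdet hg hreg`.

NOT here: the archimedean clauses `hA`, `hIinf` (L4-x2) and the global clauses `hA1`–`hA4`, `hs`, `hB1`–`hB4`.

Nothing here says anything about the status of the Hodge conjecture for CM abelian varieties, which is NOT proved
(HC_CM is NOT proved by anyone in this repository).
-/

set_option autoImplicit false
noncomputable section
namespace Summit.Ventures.HodgeRepro.Tier4.Line4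
open Summit.Ventures.HodgeRepro.Tier4 Summit.Ventures.HodgeRepro.Tier4.Common Summit.Ventures.HodgeRepro.Tier4.Line1
  MeasureTheory
open scoped ComplexConjugate Topology Pointwise NNReal

section Fin
variable {k : Type} [Field k] [NumberField k] (W : PlaneData k) [MeasurableSpace (GA W)] [BorelSpace (GA W)]
  (R : RTFData W)

/-- **`hB` at `Ffin = levelDC`**: for every `t ∈ T`, `b ↦ conj χ′(b) · levelDC (t_f⁻¹ γ₀,f b)` is `ν′_f`-integrable —
continuous with compact support (the trace on `T′_f` of a compact translate of the double coset). -/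
theorem integrable_conj_chi'_mul_levelDC (hc' : Continuous R.chi')
    (νf' : Measure (torusFin' W)) [νf'.IsHaarMeasure] (γ₀ : GA W) {N : ℕ} (hN : N ≠ 0) (t : torusT W) :
    Integrable (fun b : torusFin' W => conj (R.chi' (b : torusT' W)) *
      levelDC W γ₀ N ((GA.ofFinPart W (t : GA W))⁻¹ * GA.ofFinPart W γ₀ * ((b : torusT' W) : GA W))) νf' := by
  haveI : T2Space (GA W) := t2Space_GA W
  haveI : BorelSpace (torusT' W) := Subtype.borelSpace _
  haveI : BorelSpace (torusFin' W) := Subtype.borelSpace _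
  set ι : torusFin' W → GA W := fun b => ((b : torusT' W) : GA W) with hι
  have hcont : Continuous (fun b : torusFin' W => conj (R.chi' (b : torusT' W)) *
      levelDC W γ₀ N ((GA.ofFinPart W (t : GA W))⁻¹ * GA.ofFinPart W γ₀ * ι b)) :=
    (Complex.continuous_conj.comp (hc'.comp continuous_subtype_val)).mul
      ((continuous_levelDC W γ₀ N hN).comp
        (continuous_const.mul (continuous_subtype_val.comp continuous_subtype_val)))
  have hK : IsCompact (ι ⁻¹' (((GA.ofFinPart W γ₀)⁻¹ * GA.ofFinPart W (t : GA W)) •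
      levelDoubleCoset W N (GA.ofFinPart W γ₀))) :=
    (isClosedEmbedding_torusFin'_coe W).isCompact_preimage ((isCompact_levelDoubleCoset W hN _).smul _)
  have hsupp : HasCompactSupport (fun b : torusFin' W => conj (R.chi' (b : torusT' W)) *
      levelDC W γ₀ N ((GA.ofFinPart W (t : GA W))⁻¹ * GA.ofFinPart W γ₀ * ι b)) := by
    refine HasCompactSupport.of_support_subset_isCompact hK ?_
    intro b hb
    have hne : levelDC W γ₀ N ((GA.ofFinPart W (t : GA W))⁻¹ * GA.ofFinPart W γ₀ * ι b) ≠ 0 := by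
      intro h0
      exact hb (by simp only [h0, mul_zero])
    have hfin : (GA.ofFinPart W (t : GA W))⁻¹ * GA.ofFinPart W γ₀ * ι b ∈ finitePart W :=
      (finitePart W).mul_mem ((finitePart W).mul_mem ((finitePart W).inv_mem (ofFinPart_mem_finitePart W _))
        (ofFinPart_mem_finitePart W γ₀)) (Subgroup.mem_subgroupOf.1 b.2)
    have hmem := mem_levelDoubleCoset_of_levelDC_ne_zero W γ₀ N hfin hne
    show ι b ∈ ((GA.ofFinPart W γ₀)⁻¹ * GA.ofFinPart W (t : GA W)) • levelDoubleCoset W N (GA.ofFinPart W γ₀)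
    refine Set.mem_smul_set.2 ⟨_, hmem, ?_⟩
    rw [smul_eq_mul]
    group
  exact hcont.integrable_of_hasCompactSupport hsupp

/-- **`hIfin` at `Ffin = levelDC`** (PROPER and ZDOMAIN-EX (iv) as binders): `b ↦ χ(b) · innerFin (levelDC) γ₀ ν′_f b`
is `ν_f`-integrable on `DZ_f` — L2-p1's `integrableOn_chi_mul_innerFin` at the compactly supported continuous
`levelDC`. -/
theorem integrableOn_chi_mul_innerFin_levelDC (hc : Continuous R.chi) (hu : ∀ a, ‖R.chi a‖ = 1)
    (hc' : Continuous R.chi') (hu' : ∀ a, ‖R.chi' a‖ = 1)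
    (νf : Measure (torusFin W)) [νf.IsHaarMeasure] (νf' : Measure (torusFin' W)) [νf'.IsHaarMeasure]
    (γ₀ : GA W) {N : ℕ} (hN : N ≠ 0) (hprop : HasProperFinOrbit W γ₀) (DZf : Set (torusFin W))
    (hDZf : MeasurableSet DZf)
    (hDZc : ∀ C : Set (torusFin W), IsCompact C → IsCompact (closure (DZf ∩ (C * (ZfIn W : Set (torusFin W)))))) :
    IntegrableOn (fun b : torusFin W => R.chi b * innerFin W R (levelDC W γ₀ N) γ₀ νf' b) DZf νf :=
  integrableOn_chi_mul_innerFin W R hc hu hc' hu' νf νf' (levelDC W γ₀ N) (continuous_levelDC W γ₀ N hN)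
    (levelDoubleCoset W N (GA.ofFinPart W γ₀)) (isCompact_levelDoubleCoset W hN _)
    (fun _ hg h => mem_levelDoubleCoset_of_levelDC_ne_zero W γ₀ N hg h) γ₀ hprop DZf hDZf hDZc

/-- **`hint` at `Ffin = levelDC`** (PROPER and ZDOMAIN-EX (iv) as binders): `(b, b′) ↦ χ(b) conj χ′(b′) levelDC
(b⁻¹ γ₀,f b′)` is `(ν_f ⊗ ν′_f)`-integrable on `DZ_f × T′_f` — L2-p1's `integrableOn_chi_conj_chi'_Ffin_prod` at
`levelDC`. -/
theorem integrableOn_chi_conj_chi'_levelDC_prod (hc : Continuous R.chi) (hu : ∀ a, ‖R.chi a‖ = 1)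
    (hc' : Continuous R.chi') (hu' : ∀ a, ‖R.chi' a‖ = 1)
    (νf : Measure (torusFin W)) [νf.IsHaarMeasure] (νf' : Measure (torusFin' W)) [νf'.IsHaarMeasure]
    (γ₀ : GA W) {N : ℕ} (hN : N ≠ 0) (hprop : HasProperFinOrbit W γ₀) (DZf : Set (torusFin W))
    (hDZf : MeasurableSet DZf)
    (hDZc : ∀ C : Set (torusFin W), IsCompact C → IsCompact (closure (DZf ∩ (C * (ZfIn W : Set (torusFin W)))))) :
    IntegrableOn (fun p : torusFin W × torusFin' W => R.chi p.1 * conj (R.chi' p.2) *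
      levelDC W γ₀ N ((((p.1 : torusT W) : GA W))⁻¹ * GA.ofFinPart W γ₀ * ((p.2 : torusT' W) : GA W)))
      (DZf ×ˢ Set.univ) (νf.prod νf') :=
  integrableOn_chi_conj_chi'_Ffin_prod W R hc hu hc' hu' νf νf' (levelDC W γ₀ N) (continuous_levelDC W γ₀ N hN)
    (levelDoubleCoset W N (GA.ofFinPart W γ₀)) (isCompact_levelDoubleCoset W hN _)
    (fun _ hg h => mem_levelDoubleCoset_of_levelDC_ne_zero W γ₀ N hg h) γ₀ hprop DZf hDZf hDZc

/-- **The three finite-side clauses of `ChainInputs` at `Ffin = levelDC`, PROPER discharged** (L2-p3's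
`hasProperFinOrbit_of_isLinRegular (hdet) (hg) γ₀ (hreg)`): `hB ∧ hIfin ∧ hint`, in the field types of
MainTermInstance's `ChainInputs` at `γ₀ : rationalPoints W`. -/
theorem chainInputs_fin_clauses_of_isLinRegular (hc : Continuous R.chi) (hu : ∀ a, ‖R.chi a‖ = 1)
    (hc' : Continuous R.chi') (hu' : ∀ a, ‖R.chi' a‖ = 1)
    (hdet : W.B.det ≠ 0) (hg : IsGenuineRow W) (γ₀ : rationalPoints W) (hreg : IsLinRegular W γ₀)
    (νf : Measure (torusFin W)) [νf.IsHaarMeasure] (νf' : Measure (torusFin' W)) [νf'.IsHaarMeasure]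
    {N : ℕ} (hN : N ≠ 0) (DZf : Set (torusFin W)) (hDZf : MeasurableSet DZf)
    (hDZc : ∀ C : Set (torusFin W), IsCompact C → IsCompact (closure (DZf ∩ (C * (ZfIn W : Set (torusFin W)))))) :
    (∀ t : torusT W, Integrable (fun b : torusFin' W => conj (R.chi' (b : torusT' W)) *
      levelDC W (γ₀ : GA W) N ((GA.ofFinPart W t)⁻¹ * GA.ofFinPart W (γ₀ : GA W) * ((b : torusT' W) : GA W))) νf') ∧
    IntegrableOn (fun b : torusFin W => R.chi b * innerFin W R (levelDC W (γ₀ : GA W) N) (γ₀ : GA W) νf' b) DZf νf ∧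
    IntegrableOn (fun p : torusFin W × torusFin' W => R.chi p.1 * conj (R.chi' p.2) *
      levelDC W (γ₀ : GA W) N ((((p.1 : torusT W) : GA W))⁻¹ * GA.ofFinPart W (γ₀ : GA W) * ((p.2 : torusT' W) : GA W)))
      (DZf ×ˢ Set.univ) (νf.prod νf') := by
  have hprop : HasProperFinOrbit W (γ₀ : GA W) := hasProperFinOrbit_of_isLinRegular W hdet hg γ₀ hreg
  exact ⟨fun t => integrable_conj_chi'_mul_levelDC W R hc' νf' (γ₀ : GA W) hN t,
    integrableOn_chi_mul_innerFin_levelDC W R hc hu hc' hu' νf νf' (γ₀ : GA W) hN hprop DZf hDZf hDZc,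
    integrableOn_chi_conj_chi'_levelDC_prod W R hc hu hc' hu' νf νf' (γ₀ : GA W) hN hprop DZf hDZf hDZc⟩

end Fin

end Summit.Ventures.HodgeRepro.Tier4.Line4

end
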